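import Summits.CriticalPhenomena.PercolationContinuityZ3.Theorems.Transplant.BoxProdZ2ConcClosureRun
import Summits.CriticalPhenomena.PercolationContinuityZ3.Theorems.Transplant.BoxProdZ2ConcFaceReal
import Summits.CriticalPhenomena.PercolationContinuityZ3.Theorems.Transplant.BoxProdZ2KitCounts
import HarnessLib

/-!
# (S) The PARAMETER TOOLKIT of the concrete choice function `concChoice₀` (design (D), `X □ ℤ²`; owner split 15:02:43Z items (S)/(Z)):
# the consumer-independent choices and their specifications — fibre representatives, the excess radius AT THE RUNNING PARAMETER as a
# function, the kit counts as functions, the minimal accuracy, the input transfer to a coarser accuracy, the gap function of the radius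
# schedule with the schedule facts the three residues (R)/(F)/(C) consume, and the planar / level constants

builds on p205010 (kernel theorem, internal audit signed; external expert review pending) — nothing in this file uses p205010.
Status sentence (coordinator 2026-08-20T04:30Z): "θ(p_c) = 0 on ℤ^d, all d ≥ 2 — kernel-verified (Lean 4/Mathlib, standard axioms); internal adversarial
audit SIGNED 2026-08-20 04:29Z; external expert review pending."
Lane `prim-bschramm-*`, seat `prim-bschramm-stmt` (gen 6); helper file (`--supports stmt-CriticalPhenomena-4575`).
Parameter ledger: `run/shared/lean/prim/bschramm/prim-bschramm-stmt/CONC-PARAMS.md`.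

* §1 `reps X hqt` — a finite set of fibre representatives (`frame_reps : ∀ w, ∃ γ : X ≃g X, γ w ∈ reps X hqt`), the `V₀` / `hfr` of `hkits_tube`;
* §2 **`excessRadiusAt X V n η q R₀'`** — an excess radius at the RUNNING parameter `q` (classical choice in `exists_excess_radius`; `0` off
  `TubeSubcritical X q ∧ 0 < η`) with `excessRadiusAt_spec` in the exact shape of the `hR₁` / `hRex` hypotheses of `faceOblC_concGB`,
  `real_rim_le_of_radius`, `real_rim_le_of_wired_source` (`excessRadiusAt_spec_singleton`: the `τ ∈ {w₀}` form);
* §3 **`kitK / kitN / kitL`** — the Step-II/III counts of `exists_kit_counts` as functions, `kitN_eq`, `kitL_pos`, `kit_counts_at` (every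
  `q ∈ [p/2, p]`);
* §4 **`δmin κ nR δA`** `= min (min δ δ₂) (min (δr nR) δA)` (the one accuracy below every kit / route accuracy) and the input transfer
  `hstd_of_inputs_le` / `hlink_of_inputs_le` (inputs at accuracy `δin ≤ a²` give the standard estimates at `1 - a²`);
* §5 **`gapFn L' Rex ρ = 2 L' + 1 + Rex (ρ + 1)`** and, for `Λ := concRadiiGB C (gapFn L' Rex) (fun _ => 0) E₀ L'`, the schedule facts:
  `two_mul_add_le_gapFn` ((F)'s `hgap` with `R₁ ρ := Rex (ρ+1)`), `le_gapFn` ((C)'s `hgapL`), `Erad_succ_gapFn` / `sch_gapFn` ((C)'s `hsch`: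
  `Rex (E g + 1) + L' ≤ E (g+1)`), `Frad_one_gapFn` ((R)'s `Rt = F 1 - L' = E₀ + L' + 1 + Rex (E₀ + 1)`), `le_Erad_gapFn` (`E₀ ≤ E g`);
* §6 planar / level constants: `Kof K₀ = max 20 K₀`, `tOf K₀ R' = Kof K₀ * (100 (R'+1))`, **`cellsOf K₀ R' : PCells := ⟨Kof K₀, 400 (R'+1)⟩`**
  (`cellsOf_r : r = 4 t`, `hundred_mul_le_tOf : 100 R' ≤ t`, `K₀_le_cellsOf_K`), and the level window `Icc (M+1) (M+L)` (`card = L`,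
  `M + L + 3 ≤ 10 s`, `M + L + 1 ≤ 3 r` for `R' := M + L + 1`).
[cite: KozmaNitzan2024, §4 Theorem 6 (pp. 25–31): the order of constants; Lemma 10 Steps II–III (pp. 18–19); Lemma 12 (p. 24)]
-/

noncomputable section

open MeasureTheory
open scoped Classical

namespace Summit.CriticalPhenomena.PercolationContinuityZ3.Theorems

namespace Transplant

namespace BoxProdZ2

open Literature.Probability.Percolation Literature.Probability.LatticeModels SimpleGraph KNCells KNLevels
open Literature.Probability.Percolation.GM (HOct piece)
open Literature.Barriers.CriticalPhenomena (IsQuasiTransitive)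

/-! ## §1 Fibre representatives -/

section Reps

variable {W : Type} (X : SimpleGraph W)

/-- **A finite set of fibre representatives** of the quasi-transitive fibre graph (classical choice in `IsQuasiTransitive X`). [folklore] -/
def reps (hqt : IsQuasiTransitive X) : Finset W := Classical.choose hqt

/-- Every vertex is carried into `reps X hqt` by an automorphism (the `hfr` hypothesis of `hkits_tube`). [folklore] -/
theorem frame_reps (hqt : IsQuasiTransitive X) (w : W) : ∃ γ : X ≃g X, γ w ∈ reps X hqt := Classical.choose_spec hqt w

/-- … and into any larger set (e.g. `insert w₀ (reps X hqt)`). [folklore] -/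
theorem frame_of_reps_subset (hqt : IsQuasiTransitive X) {V : Finset W} (hV : reps X hqt ⊆ V) (w : W) : ∃ γ : X ≃g X, γ w ∈ V := by
  obtain ⟨γ, hγ⟩ := frame_reps X hqt w
  exact ⟨γ, hV hγ⟩

end Reps

/-! ## §2 The excess radius at the running parameter, as a function -/

section Excess

variable {W : Type} [DecidableEq W] (X : SimpleGraph W) [X.LocallyFinite]

/-- **The excess radius at the running parameter `q`** over the centres `V`, planar size `n`, tolerance `η`, entrance radius `R₀'`:
the radius of `exists_excess_radius X hT V R₀' n hη` when `TubeSubcritical X q ∧ 0 < η`, else `0`. [cite: KozmaNitzan2024, §4 Lemma 12 (p. 24)]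
[cite: MartineauSevero2019, Cor. 2.2] -/
def excessRadiusAt [Countable W] (V : Finset W) (n : ℕ) (η : ℝ) (q : unitInterval) (R₀' : ℕ) : ℕ :=
  if h : TubeSubcritical X q ∧ 0 < η then Classical.choose (exists_excess_radius X h.1 V R₀' n h.2) else 0

/-- **Specification of the excess radius** (the `hR₁` / `hRex` shape): beyond `excessRadiusAt X V n η q R₀'` the excess event of any habitat
`D ⊆ B(τ, Rw) × Λ_n`, `τ ∈ V`, with entrances at fibre radius `≤ R₀'` has probability `≤ η` at `q`. [cite: KozmaNitzan2024, §4 Lemma 12 (p. 24)] -/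
theorem excessRadiusAt_spec [Countable W] (V : Finset W) (n : ℕ) {η : ℝ} (hη : 0 < η) {q : unitInterval} (hT : TubeSubcritical X q)
    (R₀' : ℕ) : ∀ R', excessRadiusAt X V n η q R₀' ≤ R' → ∀ τ ∈ V, ∀ (Rw : ℕ) (D A : Finset (W × Site 2)),
      D ⊆ ballFin X τ Rw ×ˢ box 2 n → A ⊆ D → (∀ a ∈ A, a.1 ∈ ballFin X τ R₀') →
        (bondPercolation (X □ zdGraph 2) q).real (excess X τ R' D A) ≤ η := by
  have h : TubeSubcritical X q ∧ 0 < η := ⟨hT, hη⟩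
  rw [excessRadiusAt, dif_pos h]
  exact Classical.choose_spec (exists_excess_radius X h.1 V R₀' n h.2)

/-- The specification over a sub-family of centres. [folklore] -/
theorem excessRadiusAt_spec_subset [Countable W] {V V' : Finset W} (hV : V' ⊆ V) (n : ℕ) {η : ℝ} (hη : 0 < η) {q : unitInterval}
    (hT : TubeSubcritical X q) (R₀' : ℕ) : ∀ R', excessRadiusAt X V n η q R₀' ≤ R' → ∀ τ ∈ V', ∀ (Rw : ℕ) (D A : Finset (W × Site 2)),
      D ⊆ ballFin X τ Rw ×ˢ box 2 n → A ⊆ D → (∀ a ∈ A, a.1 ∈ ballFin X τ R₀') →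
        (bondPercolation (X □ zdGraph 2) q).real (excess X τ R' D A) ≤ η :=
  fun R' hR' τ hτ => excessRadiusAt_spec X V n hη hT R₀' R' hR' τ (hV hτ)

/-- **The `τ ∈ {w₀}` form with entrance radius `ρ + 1`** — literally the `hR₁` hypothesis of `faceOblC_concGB` for
`R₁ ρ := excessRadiusAt X V n η q (ρ + 1)`, any `V ∋ w₀`. [folklore] -/
theorem excessRadiusAt_spec_singleton [Countable W] {V : Finset W} {w₀ : W} (hw₀ : w₀ ∈ V) (n : ℕ) {η : ℝ} (hη : 0 < η)
    {q : unitInterval} (hT : TubeSubcritical X q) :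
    ∀ ρ R', excessRadiusAt X V n η q (ρ + 1) ≤ R' → ∀ τ ∈ ({w₀} : Finset W), ∀ (Rw : ℕ) (D A : Finset (W × Site 2)),
      D ⊆ ballFin X τ Rw ×ˢ box 2 n → A ⊆ D → (∀ a ∈ A, a.1 ∈ ballFin X τ (ρ + 1)) →
        (bondPercolation (X □ zdGraph 2) q).real (excess X τ R' D A) ≤ η :=
  fun ρ => excessRadiusAt_spec_subset X (Finset.singleton_subset_iff.2 hw₀) n hη hT (ρ + 1)

/-- The `τ ∈ {w₀}` form at every entrance radius `R₀'` ((C)'s `hRex`). [folklore] -/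
theorem excessRadiusAt_spec_singleton' [Countable W] {V : Finset W} {w₀ : W} (hw₀ : w₀ ∈ V) (n : ℕ) {η : ℝ} (hη : 0 < η)
    {q : unitInterval} (hT : TubeSubcritical X q) :
    ∀ R₀' R', excessRadiusAt X V n η q R₀' ≤ R' → ∀ τ ∈ ({w₀} : Finset W), ∀ (Rw : ℕ) (D A : Finset (W × Site 2)),
      D ⊆ ballFin X τ Rw ×ˢ box 2 n → A ⊆ D → (∀ a ∈ A, a.1 ∈ ballFin X τ R₀') →
        (bondPercolation (X □ zdGraph 2) q).real (excess X τ R' D A) ≤ η :=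
  fun R₀' => excessRadiusAt_spec_subset X (Finset.singleton_subset_iff.2 hw₀) n hη hT R₀'

end Excess

/-! ## §3 The kit counts as functions -/

/-- `exists_kit_counts` packaged as one triple. [folklore] -/
theorem exists_kit_counts_triple (Δ' s B : ℕ) {δ : ℝ} (hδ : 0 < δ) (p : unitInterval) (hp0 : 0 < (p : ℝ)) (hp1 : (p : ℝ) < 1) :
    ∃ kNL : ℕ × ℕ × ℕ, kNL.2.1 = kNL.1 * B ∧ 0 < kNL.2.2 ∧ ∀ q : unitInterval, (p : ℝ) / 2 ≤ q → (q : ℝ) ≤ p →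
      (1 - (q : ℝ) ^ s) ^ kNL.1 ≤ δ ∧ ∀ L' : ℕ, kNL.2.2 ≤ L' → 1 / (1 - (q : ℝ)) ^ (Δ' * kNL.2.1) ≤ δ * (L' : ℝ) := by
  obtain ⟨k, N, L, h⟩ := exists_kit_counts Δ' s B hδ p hp0 hp1
  exact ⟨(k, N, L), h⟩

/-- **The count triple `(k, N, L)`** at `(Δ', s, B, δ, p)`: seeds `k` (fixed at `p/2`), contacts `N = k · B`, levels `L` (fixed at `p`);
`(0, 0, 1)` off `0 < δ ∧ 0 < p < 1`. [cite: KozmaNitzan2024, §4 Lemma 10 Steps II–III (pp. 18–19)] -/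
def kitCounts (Δ' s B : ℕ) (δ : ℝ) (p : unitInterval) : ℕ × ℕ × ℕ :=
  if h : 0 < δ ∧ 0 < (p : ℝ) ∧ (p : ℝ) < 1 then Classical.choose (exists_kit_counts_triple Δ' s B h.1 p h.2.1 h.2.2) else (0, 0, 1)

/-- The number of seeds `k`. [folklore] -/
def kitK (Δ' s B : ℕ) (δ : ℝ) (p : unitInterval) : ℕ := (kitCounts Δ' s B δ p).1

/-- The number of contacts `N`. [folklore] -/
def kitN (Δ' s B : ℕ) (δ : ℝ) (p : unitInterval) : ℕ := (kitCounts Δ' s B δ p).2.1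

/-- The number of levels `L`. [folklore] -/
def kitL (Δ' s B : ℕ) (δ : ℝ) (p : unitInterval) : ℕ := (kitCounts Δ' s B δ p).2.2

/-- The specification of the count triple (under `0 < δ`, `0 < p < 1`). [folklore] -/
theorem kitCounts_spec (Δ' s B : ℕ) {δ : ℝ} (hδ : 0 < δ) (p : unitInterval) (hp0 : 0 < (p : ℝ)) (hp1 : (p : ℝ) < 1) :
    kitN Δ' s B δ p = kitK Δ' s B δ p * B ∧ 0 < kitL Δ' s B δ p ∧ ∀ q : unitInterval, (p : ℝ) / 2 ≤ q → (q : ℝ) ≤ p →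
      (1 - (q : ℝ) ^ s) ^ kitK Δ' s B δ p ≤ δ ∧ ∀ L' : ℕ, kitL Δ' s B δ p ≤ L' → 1 / (1 - (q : ℝ)) ^ (Δ' * kitN Δ' s B δ p) ≤ δ * (L' : ℝ) := by
  have h : 0 < δ ∧ 0 < (p : ℝ) ∧ (p : ℝ) < 1 := ⟨hδ, hp0, hp1⟩
  have e : kitCounts Δ' s B δ p = Classical.choose (exists_kit_counts_triple Δ' s B h.1 p h.2.1 h.2.2) := by
    rw [kitCounts, dif_pos h]
  have hs := Classical.choose_spec (exists_kit_counts_triple Δ' s B h.1 p h.2.1 h.2.2)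
  simp only [kitK, kitN, kitL, e]
  exact hs

/-- `N = k · B`. [folklore] -/
theorem kitN_eq (Δ' s B : ℕ) {δ : ℝ} (hδ : 0 < δ) (p : unitInterval) (hp0 : 0 < (p : ℝ)) (hp1 : (p : ℝ) < 1) :
    kitN Δ' s B δ p = kitK Δ' s B δ p * B :=
  (kitCounts_spec Δ' s B hδ p hp0 hp1).1

/-- `k · B ≤ N` (the `hN` hypothesis). [folklore] -/
theorem kitK_mul_le_kitN (Δ' s B : ℕ) {δ : ℝ} (hδ : 0 < δ) (p : unitInterval) (hp0 : 0 < (p : ℝ)) (hp1 : (p : ℝ) < 1) :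
    kitK Δ' s B δ p * B ≤ kitN Δ' s B δ p :=
  (kitN_eq Δ' s B hδ p hp0 hp1).ge

/-- `0 < L`. [folklore] -/
theorem kitL_pos (Δ' s B : ℕ) {δ : ℝ} (hδ : 0 < δ) (p : unitInterval) (hp0 : 0 < (p : ℝ)) (hp1 : (p : ℝ) < 1) :
    0 < kitL Δ' s B δ p :=
  (kitCounts_spec Δ' s B hδ p hp0 hp1).2.1

/-- **The counts work at every running parameter `q ∈ [p/2, p]`**: `(1 - q^s)^k ≤ δ` (the `hk` hypothesis) and `1/(1-q)^{Δ' N} ≤ δ · L'`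
for every `L' ≥ L` (the `hcount` hypothesis for any window with at least `L` levels). [cite: KozmaNitzan2024, §4 Lemma 10 Steps II–III (pp. 18–19)] -/
theorem kit_counts_at (Δ' s B : ℕ) {δ : ℝ} (hδ : 0 < δ) (p : unitInterval) (hp0 : 0 < (p : ℝ)) (hp1 : (p : ℝ) < 1)
    {q : unitInterval} (hq1 : (p : ℝ) / 2 ≤ q) (hq2 : (q : ℝ) ≤ p) :
    (1 - (q : ℝ) ^ s) ^ kitK Δ' s B δ p ≤ δ ∧
      ∀ L' : ℕ, kitL Δ' s B δ p ≤ L' → 1 / (1 - (q : ℝ)) ^ (Δ' * kitN Δ' s B δ p) ≤ δ * (L' : ℝ) :=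
  (kitCounts_spec Δ' s B hδ p hp0 hp1).2.2 q hq1 hq2

/-- The count bound transferred to a COARSER accuracy `δ ≤ δ'` (one triple at `δmin` serves every residue). [folklore] -/
theorem kit_counts_at_le (Δ' s B : ℕ) {δ δ' : ℝ} (hδ : 0 < δ) (hδ' : δ ≤ δ') (p : unitInterval) (hp0 : 0 < (p : ℝ)) (hp1 : (p : ℝ) < 1)
    {q : unitInterval} (hq1 : (p : ℝ) / 2 ≤ q) (hq2 : (q : ℝ) ≤ p) :
    (1 - (q : ℝ) ^ s) ^ kitK Δ' s B δ p ≤ δ' ∧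
      ∀ L' : ℕ, kitL Δ' s B δ p ≤ L' → 1 / (1 - (q : ℝ)) ^ (Δ' * kitN Δ' s B δ p) ≤ δ' * (L' : ℝ) := by
  obtain ⟨hk, hc⟩ := kit_counts_at Δ' s B hδ p hp0 hp1 hq1 hq2
  refine ⟨hk.trans hδ', fun L' hL' => (hc L' hL').trans ?_⟩
  exact mul_le_mul_of_nonneg_right hδ' (Nat.cast_nonneg _)

/-! ## §4 The minimal accuracy and the input transfer -/

/-- **The minimal accuracy** below the corridor-kit accuracy `δ`, the face-kit accuracy `δ₂`, the root-chain accuracy `δr nR` and the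
inner-route accuracy `δA`: the inputs are taken at accuracy `δmin²`. [this work] -/
def δmin (κ : ConcConsts) (nR : ℕ) (δA : ℝ) : ℝ := min (min κ.δ κ.δ₂) (min (κ.δr nR) δA)

/-- `δmin ≤ δ`. [folklore] -/
theorem δmin_le_δ (κ : ConcConsts) (nR : ℕ) (δA : ℝ) : δmin κ nR δA ≤ κ.δ := (min_le_left _ _).trans (min_le_left _ _)

/-- `δmin ≤ δ₂`. [folklore] -/
theorem δmin_le_δ₂ (κ : ConcConsts) (nR : ℕ) (δA : ℝ) : δmin κ nR δA ≤ κ.δ₂ := (min_le_left _ _).trans (min_le_right _ _)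

/-- `δmin ≤ δr nR`. [folklore] -/
theorem δmin_le_δr (κ : ConcConsts) (nR : ℕ) (δA : ℝ) : δmin κ nR δA ≤ κ.δr nR := (min_le_right _ _).trans (min_le_left _ _)

/-- `δmin ≤ δA`. [folklore] -/
theorem δmin_le_δA (κ : ConcConsts) (nR : ℕ) (δA : ℝ) : δmin κ nR δA ≤ δA := (min_le_right _ _).trans (min_le_right _ _)

/-- `0 < δmin` (for `0 < δA`). [folklore] -/
theorem δmin_pos (κ : ConcConsts) (nR : ℕ) {δA : ℝ} (hδA : 0 < δA) : 0 < δmin κ nR δA :=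
  lt_min (lt_min κ.hδ0 κ.hδ₂0) (lt_min (κ.hδr nR).1 hδA)

/-- `δmin ≤ 1`. [folklore] -/
theorem δmin_le_one (κ : ConcConsts) (nR : ℕ) (δA : ℝ) : δmin κ nR δA ≤ 1 := (δmin_le_δ κ nR δA).trans κ.hδ1

/-- `0 < δmin²`. [folklore] -/
theorem δmin_sq_pos (κ : ConcConsts) (nR : ℕ) {δA : ℝ} (hδA : 0 < δA) : 0 < δmin κ nR δA ^ 2 := pow_pos (δmin_pos κ nR hδA) 2

/-- Squares are monotone on the accuracies: `δmin ≤ a`, `0 ≤ δmin` ⟹ `δmin² ≤ a²`. [folklore] -/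
theorem δmin_sq_le {κ : ConcConsts} {nR : ℕ} {δA a : ℝ} (hδA : 0 < δA) (h : δmin κ nR δA ≤ a) : δmin κ nR δA ^ 2 ≤ a ^ 2 :=
  pow_le_pow_left₀ (δmin_pos κ nR hδA).le h 2

section Inputs

variable {W : Type} [DecidableEq W] (X : SimpleGraph W) [X.LocallyFinite]

/-- **Input transfer to a coarser accuracy** (`hstd` shape): inputs over `V₀ × S` at accuracy `δin ≤ a²` at `q` give, at every scale
`M ∈ S`, the uniqueness-zone and the eight link estimates with `1 - a²`. [folklore] -/
theorem hstd_of_inputs_le [Countable W] {p : unitInterval} (hT : TubeSubcritical X p) (V₀ : Finset W) (msel : W → ℕ) {S : Finset ℕ}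
    {q : unitInterval} {δin a : ℝ} (ha : δin ≤ a ^ 2)
    (h : ∀ i ∈ inputIndex V₀ S, 1 - δin < (bondPercolation (X □ zdGraph 2) q).real (inputEvent X hT V₀ msel i)) {M : ℕ} (hM : M ∈ S) :
    ∀ τ ∈ V₀,
      1 - a ^ 2 < (bondPercolation (X □ zdGraph 2) q).real (UniqZone.zone (X □ zdGraph 2) (ufatSeq X hT V₀ τ) (msel τ) M) ∧
      ∀ g : HOct 2, 1 - a ^ 2 < (bondPercolation (X □ zdGraph 2) q).real
        (linkIn (↑(ufatSeq X hT V₀ τ M)) (ufatSeq X hT V₀ τ (msel τ)) (ballFin X τ (ufatRadius X hT V₀ M) ×ˢ piece g M)) := by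
  intro τ hτ
  obtain ⟨h1, h2⟩ := hstd_of_inputs X hT V₀ msel h hM τ hτ
  exact ⟨by linarith, fun g => by linarith [h2 g]⟩

/-- **Input transfer, link form over a scale interval** (`hlink` shape): for `Icc ℓ₀ ℓ₁ ⊆ S`, every scale `ℓ ∈ [ℓ₀, ℓ₁]` has the eight link
estimates with `1 - a²`. [folklore] -/
theorem hlink_of_inputs_le [Countable W] {p : unitInterval} (hT : TubeSubcritical X p) (V₀ : Finset W) (msel : W → ℕ) {S : Finset ℕ}
    {q : unitInterval} {δin a : ℝ} (ha : δin ≤ a ^ 2)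
    (h : ∀ i ∈ inputIndex V₀ S, 1 - δin < (bondPercolation (X □ zdGraph 2) q).real (inputEvent X hT V₀ msel i)) {ℓ₀ ℓ₁ : ℕ}
    (hS : Finset.Icc ℓ₀ ℓ₁ ⊆ S) :
    ∀ ℓ, ℓ₀ ≤ ℓ → ℓ ≤ ℓ₁ → ∀ τ ∈ V₀, ∀ g : HOct 2, 1 - a ^ 2 < (bondPercolation (X □ zdGraph 2) q).real
      (linkIn (↑(ufatSeq X hT V₀ τ ℓ)) (ufatSeq X hT V₀ τ (msel τ)) (ballFin X τ (ufatRadius X hT V₀ ℓ) ×ˢ piece g ℓ)) :=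
  fun ℓ h₀ h₁ τ hτ g => ((hstd_of_inputs_le X hT V₀ msel ha h (M := ℓ) (hS (Finset.mem_Icc.2 ⟨h₀, h₁⟩))) τ hτ).2 g

end Inputs

/-! ## §5 The gap function and the schedule facts -/

/-- **The gap function of the (D) schedule**: `gap ρ = 2 L' + 1 + Rex (ρ + 1)` — two collars of width `L'` (the true target sits `L'` inside
the far box and its rim a further `L'` inside), one spare unit, and the excess radius for entrances at fibre radius `ρ + 1`. [this work] -/
def gapFn (L' : ℕ) (Rex : ℕ → ℕ) (ρ : ℕ) : ℕ := 2 * L' + 1 + Rex (ρ + 1)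

/-- (F)'s schedule condition `2 L' + R₁ ρ ≤ gap ρ` with `R₁ ρ := Rex (ρ + 1)`. [folklore] -/
theorem two_mul_add_le_gapFn (L' : ℕ) (Rex : ℕ → ℕ) (ρ : ℕ) : 2 * L' + Rex (ρ + 1) ≤ gapFn L' Rex ρ := by
  unfold gapFn; omega

/-- (C)'s `hgapL`: `L' ≤ gap ρ`. [folklore] -/
theorem le_gapFn (L' : ℕ) (Rex : ℕ → ℕ) (ρ : ℕ) : L' ≤ gapFn L' Rex ρ := by unfold gapFn; omega

/-- `1 ≤ gap ρ`. [folklore] -/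
theorem one_le_gapFn (L' : ℕ) (Rex : ℕ → ℕ) (ρ : ℕ) : 1 ≤ gapFn L' Rex ρ := by unfold gapFn; omega

/-- `L' + 1 + Rex (ρ + 1) ≤ gap ρ`. [folklore] -/
theorem add_one_add_le_gapFn (L' : ℕ) (Rex : ℕ → ℕ) (ρ : ℕ) : L' + 1 + Rex (ρ + 1) ≤ gapFn L' Rex ρ := by unfold gapFn; omega

/-- With `gap' = 0`: `E (g+1) = E g + gap (E g)`. [folklore] -/
theorem Erad_succ_gapFn (L' : ℕ) (Rex : ℕ → ℕ) (E₀ g : ℕ) :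
    Erad (gapFn L' Rex) (fun _ => 0) E₀ (g + 1) = Erad (gapFn L' Rex) (fun _ => 0) E₀ g + gapFn L' Rex (Erad (gapFn L' Rex) (fun _ => 0) E₀ g) := by
  rw [Erad_succ, Frad_succ]; rfl

/-- With `gap' = 0`: `F (g+1) = E (g+1)`. [folklore] -/
theorem Frad_succ_gapFn (L' : ℕ) (Rex : ℕ → ℕ) (E₀ g : ℕ) :
    Frad (gapFn L' Rex) (fun _ => 0) E₀ (g + 1) = Erad (gapFn L' Rex) (fun _ => 0) E₀ (g + 1) := by
  rw [Erad_succ_gapFn, Frad_succ]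

/-- **(C)'s schedule condition `hsch`**: `Rex (E g + 1) + L' ≤ E (g + 1)`. [folklore] -/
theorem sch_gapFn (L' : ℕ) (Rex : ℕ → ℕ) (E₀ : ℕ) :
    ∀ g, Rex (Erad (gapFn L' Rex) (fun _ => 0) E₀ g + 1) + L' ≤ Erad (gapFn L' Rex) (fun _ => 0) E₀ (g + 1) := by
  intro g
  rw [Erad_succ_gapFn, gapFn]
  omega

/-- The stronger form: `E g + 2 L' + 1 + Rex (E g + 1) ≤ E (g + 1)` (with equality). [folklore] -/
theorem Erad_succ_gapFn_eq (L' : ℕ) (Rex : ℕ → ℕ) (E₀ g : ℕ) :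
    Erad (gapFn L' Rex) (fun _ => 0) E₀ (g + 1) = Erad (gapFn L' Rex) (fun _ => 0) E₀ g + 2 * L' + 1 + Rex (Erad (gapFn L' Rex) (fun _ => 0) E₀ g + 1) := by
  rw [Erad_succ_gapFn, gapFn]; omega

/-- `F (g+1) - L' = E g + L' + 1 + Rex (E g + 1)` (the true target radius one level up). [folklore] -/
theorem Frad_succ_sub_gapFn (L' : ℕ) (Rex : ℕ → ℕ) (E₀ g : ℕ) :
    Frad (gapFn L' Rex) (fun _ => 0) E₀ (g + 1) - L' =
      Erad (gapFn L' Rex) (fun _ => 0) E₀ g + L' + 1 + Rex (Erad (gapFn L' Rex) (fun _ => 0) E₀ g + 1) := by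
  rw [Frad_succ, gapFn]; omega

/-- **(R)'s tube radius**: `F 1 - L' = E₀ + L' + 1 + Rex (E₀ + 1)` (`Rt := rM 0 child = F 1 - L'`). [folklore] -/
theorem Frad_one_gapFn (L' : ℕ) (Rex : ℕ → ℕ) (E₀ : ℕ) :
    Frad (gapFn L' Rex) (fun _ => 0) E₀ 1 - L' = E₀ + L' + 1 + Rex (E₀ + 1) := by
  have h := Frad_succ_sub_gapFn L' Rex E₀ 0
  simpa using h

/-- `E₀ ≤ E g`. [folklore] -/
theorem le_Erad_gapFn (L' : ℕ) (Rex : ℕ → ℕ) (E₀ g : ℕ) : E₀ ≤ Erad (gapFn L' Rex) (fun _ => 0) E₀ g := by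
  simpa using Erad_mono (gapFn L' Rex) (fun _ => 0) E₀ (Nat.zero_le g)

/-- `E g + L' ≤ E (g+1) - L'` hence `L' ≤ E (g+1) - L'` etc.: the collar arithmetic one level up. [folklore] -/
theorem Erad_add_le_Erad_succ_sub (L' : ℕ) (Rex : ℕ → ℕ) (E₀ g : ℕ) :
    Erad (gapFn L' Rex) (fun _ => 0) E₀ g + L' + 1 + Rex (Erad (gapFn L' Rex) (fun _ => 0) E₀ g + 1) ≤
      Erad (gapFn L' Rex) (fun _ => 0) E₀ (g + 1) - L' := by
  rw [Erad_succ_gapFn_eq]; omega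

/-! ## §6 Planar and level constants -/

/-- The number of stub levels `K := max 20 K₀`. [this work] -/
def Kof (K₀ : ℕ) : ℕ := max 20 K₀

/-- `20 ≤ K`. [folklore] -/
theorem twenty_le_Kof (K₀ : ℕ) : 20 ≤ Kof K₀ := le_max_left _ _

/-- `K₀ ≤ K`. [folklore] -/
theorem le_Kof (K₀ : ℕ) : K₀ ≤ Kof K₀ := le_max_right _ _

/-- The chain unit `t := K · (100 (R' + 1))` (so that `r = K s = 4 t` for `s := 400 (R' + 1)` and `100 R' ≤ t`). [this work] -/
def tOf (K₀ R' : ℕ) : ℕ := Kof K₀ * (100 * (R' + 1))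

/-- **The planar cells**: `K := max 20 K₀` stub levels, stub increment `s := 400 (R' + 1)`. [this work] -/
def cellsOf (K₀ R' : ℕ) : PCells where
  K := Kof K₀
  s := 400 * (R' + 1)
  hK := twenty_le_Kof K₀
  hs := by omega

/-- `(cellsOf K₀ R').K = max 20 K₀`. [folklore] -/
@[simp] theorem cellsOf_K (K₀ R' : ℕ) : (cellsOf K₀ R').K = Kof K₀ := rfl

/-- `(cellsOf K₀ R').s = 400 (R' + 1)`. [folklore] -/
@[simp] theorem cellsOf_s (K₀ R' : ℕ) : (cellsOf K₀ R').s = 400 * (R' + 1) := rfl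

/-- `K₀ ≤ (cellsOf K₀ R').K` (the `K₀ ≤ C.K` clause of `WFHolds`). [folklore] -/
theorem K₀_le_cellsOf_K (K₀ R' : ℕ) : K₀ ≤ (cellsOf K₀ R').K := le_Kof K₀

/-- **`r = 4 t`** (the `hr` hypothesis of the tube chains). [folklore] -/
theorem cellsOf_r (K₀ R' : ℕ) : (cellsOf K₀ R').r = 4 * tOf K₀ R' := by
  simp only [PCells.r, cellsOf_K, cellsOf_s, tOf]; ring

/-- `100 (R' + 1) ≤ t`, hence `100 R' ≤ t`. [folklore] -/
theorem hundred_mul_succ_le_tOf (K₀ R' : ℕ) : 100 * (R' + 1) ≤ tOf K₀ R' := by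
  have h := twenty_le_Kof K₀
  unfold tOf; nlinarith

/-- `100 R' ≤ t` (p2-g2's `hR`). [folklore] -/
theorem hundred_mul_le_tOf (K₀ R' : ℕ) : 100 * R' ≤ tOf K₀ R' := le_trans (by omega) (hundred_mul_succ_le_tOf K₀ R')

/-- `R' + 1 ≤ t`. [folklore] -/
theorem succ_le_tOf (K₀ R' : ℕ) : R' + 1 ≤ tOf K₀ R' := le_trans (by omega) (hundred_mul_succ_le_tOf K₀ R')

/-- The level count of the window `Icc (M+1) (M+L)` is `L`. [folklore] -/
theorem card_Icc_levels (M L : ℕ) : (Finset.Icc (M + 1) (M + L)).card = L := by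
  rw [Nat.card_Icc]; omega

/-- With `R' := M + L + 1`: `(M + L) + 3 ≤ 10 s` ((F)'s `hRlev` for `Rlev := M + L`). [folklore] -/
theorem levels_le_ten_mul_s (K₀ M L : ℕ) : M + L + 3 ≤ 10 * (cellsOf K₀ (M + L + 1)).s := by
  rw [cellsOf_s]; omega

/-- With `R' := M + L + 1`: `(M + L) + 1 ≤ 3 r` ((F)'s `hRlev'`). [folklore] -/
theorem levels_le_three_mul_r (K₀ M L : ℕ) : M + L + 1 ≤ 3 * (cellsOf K₀ (M + L + 1)).r := by
  have h1 := (cellsOf K₀ (M + L + 1)).twenty_mul_s_le_r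
  rw [cellsOf_s] at h1
  omega

/-- With `R' := M + L + 1`: `10 s ≥ L + 2 M + 2` (the `hwide` arithmetic: a window of `L` levels plus kit cubes of scale `M` fits in a stub
level of width `10 s`). [folklore] -/
theorem wide_le_ten_mul_s (K₀ M L : ℕ) : L + 2 * M + 2 ≤ 10 * (cellsOf K₀ (M + L + 1)).s := by
  rw [cellsOf_s]; omega

/-- `M < 6 t` for `R' := M + L + 1` (the kit scale lies below the top route scale `ℓ₁ = 6 t`). [folklore] -/
theorem lt_six_mul_tOf (K₀ M L : ℕ) : M < 6 * tOf K₀ (M + L + 1) := by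
  have h := succ_le_tOf K₀ (M + L + 1); omega

/-- Every scale of `Icc M₀ (6 t)` is `≥ M₀` (the `S_ge` field of `ConcChoice`). [folklore] -/
theorem le_of_mem_Icc_scales {M₀ n M : ℕ} (h : M ∈ Finset.Icc M₀ n) : M₀ ≤ M := (Finset.mem_Icc.1 h).1

end BoxProdZ2

end Transplant

end Summit.CriticalPhenomena.PercolationContinuityZ3.Theorems

end
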